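import Mathlib
import Summits.ValiantsHypothesis.ValiantsHypothesis.Theorems.KPlusLogSqLawWeakLiftingTowerGraftSkewBlockCornerMixing
import Summits.ValiantsHypothesis.ValiantsHypothesis.Theorems.KPlusLogSqLawWeakLiftingTowerGraftSkewBlockIdentityGraftSharpTower

/-!
# Tower graft line — Θ(m²) CORNER-GRAFT PHANTOMS AT EVERY EVEN SIZE, EVERY EXPONENT, ALSO INSIDE `IsTower` (S4b's object; the last
# LOCATED row of the NO-GO ledger goes KERNEL)

Calibration file for the line `Cruxes/WeakLifting/Lines/tower_graft.lean` (crux `WeakLifting` = stmt-ValiantsHypothesis-19561), object of S4b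
`stub_graftLawCorner`.  NO stub is claimed.  Companion of `…SkewBlockCornerMixing.lean` (`skewBlock_cornerGraft_of_sharp`: ROOT COUNTING + ONE
UNIPOTENT COLUMN MIXING suffice for corner phantoms, every exponent).

* `skewBlock_cornerGraft_quadratic (q)` — fed with the tree's DESCARTES-SHARP SYMMETRIC `(k,3)` FAMILY (`…KThreeColumnLawHolds.not_posRootLawAt_three`,
  `ζ_sym(k,3) = C(k+2,2) − 1`, `k = q+1`; monomial ceiling `…StubDescartesCeiling.card_support_det_pencil_le`): a three-letter support `d` and
  (column-mixed) blocks `B` of size `q+1` such that FOR EVERY exponent `D` some `η > 0` gives `Z₊(det G_η) = 0`, `Z₊(det (G_η)″) = 0` and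
  `Z₊(det(G_η + X^D·E)) ≥ 2·(C(q+3,2) − 1) = (q+1)(q+4) = m²/4 + 3m/2` (`m = 2(q+1)` the size of `G_η`; corner `E = E_{inr 0, inr 0}`).
* `skewBlock_cornerGraft_quadratic_tower (q)` — the same ON A GENUINE `m`-TOWER: support `(0, 1, D)` with `2(q+1)·1 < D` (the arrowhead Lagrange
  tower blocks `witnessLetters (q+1) D` by name, p706847's `le_card_posRoots_witness`, column-mixed), the tower inequalities and a bound for the
  exponents above the tower as conjuncts, and the phantom count for EVERY corner exponent `D'` — in particular every `D'` above the tower, where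
  S4b quantifies.
* `cornerGraft_quadratic_tower_fin (q)` — THE PLANNERS' SHAPE (the object of `TowerGraftLawCorner` verbatim): ONE index type `Fin (2q+2)`, symmetric
  letters `S`, corner letter `(vecMulVec eᵢ eᵢ).map C`, principal minor `G.submatrix i.succAbove i.succAbove`; transport along
  `Fin (q+1) ⊕ Fin (q+1) ≃ Fin (2q+2)` (`det_submatrix_equiv_self`; the two corner deletions agree up to a relabelling, `det_submatrix_eq_of_range`).

READING (NO-GO ledger `HOME/val-sym-lift-p2/g20/NOGO-LEDGER-KERNEL-liftp2g20.md` §2/§4, kill-shape #38⁺): the row «any additive term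
`g(m) = o(ζ₊(m;d))`, in particular `o(m²)`, for an instance-level CORNER law `Z₊(det(G + X^D·Eᵢᵢ)) ≤ c·(Z₊(det G) + Z₊(det Gᵢᵢ)) + g`» was LOCATED
(pinned column; located-exact linear planting `plantk.py` to m = 14); it is now KERNEL at every even `m`, with BOTH digits rootless, for every
exponent and inside `IsTower` — the corner row and the identity row (p706281 / p706847) of the ledger now read the same.  Every count is inside
the class budget (`B ≥ ζ₊(m;d) ≥ C(m+2,2) − 1 > m²/4 + 3m/2`): ZERO crux credit, S4b at `C = 1` pays; S4b's own currency (the class maximum)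
is the only surviving additive term.
HONEST FRAMING: nothing on S4/S4b/S5/S5ᴸ, TowerB, `WeakLifting`, Conjecture B, `MatrixDescartes` (18050) or `VP ≠ VNP`.  Def-free.
Seat: prover val-sym-lift-p2 g21, `--supports stmt-ValiantsHypothesis-19561`.
-/

-- `Summit.ValiantsHypothesis.ValiantsHypothesis.…` repeats a component by the D-0017 layout
-- (single-conjunct summit), which the `dupNamespace` linter flags; the name is mandated.
set_option linter.dupNamespace false

namespace Summit.ValiantsHypothesis.ValiantsHypothesis.Theorems.KPlusLogSqLaw.TowerGraft

open Polynomial Matrix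
open scoped BigOperators Polynomial

section CornerGraftQuadratic

open Summit.ValiantsHypothesis.ValiantsHypothesis.Theorems.LacunarySymmetroidMatrixDescartes.Census.LagrangeTower

open Summit.ValiantsHypothesis.ValiantsHypothesis.Theorems.MatrixDescartes.Negative (PosRootLawAt) in
/-- **Θ(m²) CORNER-GRAFT PHANTOMS AT EVERY EVEN SIZE, EVERY FAR EXPONENT** (S4b's object; calibration): for every `q` there are a
three-letter support `d` and blocks `B` of size `q+1` such that for every exponent `D` some `η > 0` makes
the symmetric skew-block pencil `G_η` of size `m = 2(q+1)` have
NO positive root of `det G_η`, NO positive root of the principal minor `det (G_η)″` at the corner, while the corner graft `det(G_η + X^D·E)`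
has at least `(q+1)(q+4) = m²/4 + 3m/2` distinct positive roots.  Data: the tree's Descartes-sharp symmetric `(q+1, 3)` family
(`not_posRootLawAt_three`) after a unipotent column mixing, through `skewBlock_cornerGraft_of_sharp`. [this work] -/
theorem skewBlock_cornerGraft_quadratic (q : ℕ) :
    ∃ (d : Fin 3 → ℕ) (B : Fin 3 → Matrix (Fin (q + 1)) (Fin (q + 1)) ℝ), ∀ D : ℕ, ∃ η : ℝ, 0 < η ∧
      ((∑ l, (X : ℝ[X]) ^ d l • (Matrix.fromBlocks (if l = 0 then η • (1 : Matrix (Fin (q + 1)) (Fin (q + 1)) ℝ) else 0)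
        (B l) (B l)ᵀ (if l = 0 then -(η • (1 : Matrix (Fin (q + 1)) (Fin (q + 1)) ℝ)) else 0)).map C).det.roots.toFinset.filter
        (fun t => 0 < t)).card = 0 ∧
      (((∑ l, (X : ℝ[X]) ^ d l • (Matrix.fromBlocks (if l = 0 then η • (1 : Matrix (Fin (q + 1)) (Fin (q + 1)) ℝ) else 0)
        (B l) (B l)ᵀ (if l = 0 then -(η • (1 : Matrix (Fin (q + 1)) (Fin (q + 1)) ℝ)) else 0)).map C).submatrix
        (Sum.map id (0 : Fin (q + 1)).succAbove) (Sum.map id (0 : Fin (q + 1)).succAbove)).det.roots.toFinset.filter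
        (fun t => 0 < t)).card = 0 ∧
      (q + 1) * (q + 4) ≤ ((((∑ l, (X : ℝ[X]) ^ d l • (Matrix.fromBlocks (if l = 0 then η • (1 : Matrix (Fin (q + 1)) (Fin (q + 1)) ℝ) else 0)
          (B l) (B l)ᵀ (if l = 0 then -(η • (1 : Matrix (Fin (q + 1)) (Fin (q + 1)) ℝ)) else 0)).map C) +
        (X : ℝ[X]) ^ D • Matrix.single (Sum.inr 0 : Fin (q + 1) ⊕ Fin (q + 1)) (Sum.inr 0) (1 : ℝ[X])).det).roots.toFinset.filter
        (fun t => 0 < t)).card := by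
  classical
  have hsharpFam := LacunarySymmetroidMatrixDescartes.Census.LagrangeTower.not_posRootLawAt_three (q + 1) (by omega)
  simp only [PosRootLawAt, not_forall, not_le, exists_prop] at hsharpFam
  obtain ⟨d, S, -, hcard⟩ := hsharpFam
  have hch : Nat.choose (q + 1 + 2) 2 = Nat.choose (q + 3) 2 := by rw [show q + 1 + 2 = q + 3 by ring]
  rw [hch] at hcard
  have hdet : (∑ l, (X : ℝ[X]) ^ d l • (S l).map C).det ≠ 0 := by
    intro h0
    rw [h0, Polynomial.roots_zero, Multiset.toFinset_zero, Finset.filter_empty, Finset.card_empty] at hcard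
    have h2 : Nat.choose (0 + 3) 2 ≤ Nat.choose (q + 3) 2 := Nat.choose_le_choose 2 (by omega)
    have h3 : Nat.choose (0 + 3) 2 = 3 := by decide
    omega
  have hsupp := LacunarySymmetroidMatrixDescartes.StubDescartesCeiling.card_support_det_pencil_le d S
  have hch2 : Nat.choose (q + 1 + 3 - 1) (q + 1) = Nat.choose (q + 3) 2 := by
    rw [show q + 1 + 3 - 1 = q + 3 by omega, show q + 3 = (q + 1) + 2 by ring, Nat.choose_symm_add]
  rw [hch2] at hsupp
  have hsharp : (∑ l, (X : ℝ[X]) ^ d l • (S l).map C).det.support.card ≤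
      ((∑ l, (X : ℝ[X]) ^ d l • (S l).map C).det.roots.toFinset.filter (fun t => 0 < t)).card + 1 := by omega
  obtain ⟨P, -, hP⟩ := skewBlock_cornerGraft_of_sharp d 0 S hdet hsharp
  refine ⟨d, fun l => S l * P, fun D => ?_⟩
  obtain ⟨η, hη, h1, h2, h3⟩ := hP D
  refine ⟨η, hη, h1, h2, le_trans ?_ h3⟩
  have := two_mul_choose_sub_one q
  omega

/-- **Θ(m²) CORNER-GRAFT PHANTOMS ON GENUINE TOWERS, every even size, every exponent** (S4b's object INSIDE `IsTower`; calibration).  For every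
`q` (`k = q+1`, `m = 2k`): the column-mixed arrowhead Lagrange tower blocks on the support `(0, 1, D)` — an `m`-tower — give, for EVERY
exponent `D'` (in particular every `D'` above the tower, `2(q+1)·D < D'`, where S4b quantifies), an `η > 0` with `Z₊(det G_η) = 0`,
`Z₊(det (G_η)″) = 0` and `Z₊(det(G_η + X^{D'}·E)) ≥ (q+1)(q+4) = m²/4 + 3m/2`. [this work] -/
theorem skewBlock_cornerGraft_quadratic_tower (q : ℕ) :
    ∃ (D : ℕ) (B : Fin 3 → Matrix (Fin (q + 1)) (Fin (q + 1)) ℝ),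
      (∀ l l' : Fin 3, l < l' → 2 * (q + 1) * (![0, 1, D] : Fin 3 → ℕ) l < (![0, 1, D] : Fin 3 → ℕ) l') ∧
      (∀ l : Fin 3, 2 * (q + 1) * (![0, 1, D] : Fin 3 → ℕ) l < 2 * (q + 1) * D + 1) ∧
      ∀ D' : ℕ, ∃ η : ℝ, 0 < η ∧
      ((∑ l, (X : ℝ[X]) ^ (![0, 1, D] : Fin 3 → ℕ) l •
        (Matrix.fromBlocks (if l = 0 then η • (1 : Matrix (Fin (q + 1)) (Fin (q + 1)) ℝ) else 0)
        (B l) (B l)ᵀ (if l = 0 then -(η • (1 : Matrix (Fin (q + 1)) (Fin (q + 1)) ℝ)) else 0)).map C).det.roots.toFinset.filter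
        (fun t => 0 < t)).card = 0 ∧
      (((∑ l, (X : ℝ[X]) ^ (![0, 1, D] : Fin 3 → ℕ) l •
        (Matrix.fromBlocks (if l = 0 then η • (1 : Matrix (Fin (q + 1)) (Fin (q + 1)) ℝ) else 0)
        (B l) (B l)ᵀ (if l = 0 then -(η • (1 : Matrix (Fin (q + 1)) (Fin (q + 1)) ℝ)) else 0)).map C).submatrix
        (Sum.map id (0 : Fin (q + 1)).succAbove) (Sum.map id (0 : Fin (q + 1)).succAbove)).det.roots.toFinset.filter
        (fun t => 0 < t)).card = 0 ∧
      (q + 1) * (q + 4) ≤ ((((∑ l, (X : ℝ[X]) ^ (![0, 1, D] : Fin 3 → ℕ) l •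
          (Matrix.fromBlocks (if l = 0 then η • (1 : Matrix (Fin (q + 1)) (Fin (q + 1)) ℝ) else 0) (B l) (B l)ᵀ
          (if l = 0 then -(η • (1 : Matrix (Fin (q + 1)) (Fin (q + 1)) ℝ)) else 0)).map C) +
        (X : ℝ[X]) ^ D' • Matrix.single (Sum.inr 0 : Fin (q + 1) ⊕ Fin (q + 1)) (Sum.inr 0) (1 : ℝ[X])).det).roots.toFinset.filter
        (fun t => 0 < t)).card := by
  classical
  obtain ⟨D, hDb, hcard⟩ := le_card_posRoots_witness (q + 1) (by omega) (2 * (q + 1) + 1)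
  have hexps : witnessExps D = (![0, 1, D] : Fin 3 → ℕ) := rfl
  rw [hexps] at hcard
  have hch : Nat.choose (q + 1 + 2) 2 = Nat.choose (q + 3) 2 := by rw [show q + 1 + 2 = q + 3 by ring]
  rw [hch] at hcard
  set S := witnessLetters (q + 1) D with hS
  have hcard' : Nat.choose (q + 3) 2 - 1 ≤
      ((∑ l, (X : ℝ[X]) ^ (![0, 1, D] : Fin 3 → ℕ) l • (S l).map C).det.roots.toFinset.filter (fun t => 0 < t)).card := hcard
  clear hcard
  have hdet : (∑ l, (X : ℝ[X]) ^ (![0, 1, D] : Fin 3 → ℕ) l • (S l).map C).det ≠ 0 := by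
    intro h0
    rw [h0, Polynomial.roots_zero, Multiset.toFinset_zero, Finset.filter_empty, Finset.card_empty] at hcard'
    have h2 : Nat.choose (0 + 3) 2 ≤ Nat.choose (q + 3) 2 := Nat.choose_le_choose 2 (by omega)
    have h3 : Nat.choose (0 + 3) 2 = 3 := by decide
    omega
  have hsupp := LacunarySymmetroidMatrixDescartes.StubDescartesCeiling.card_support_det_pencil_le (![0, 1, D] : Fin 3 → ℕ) S
  have hch2 : Nat.choose (q + 1 + 3 - 1) (q + 1) = Nat.choose (q + 3) 2 := by
    rw [show q + 1 + 3 - 1 = q + 3 by omega, show q + 3 = (q + 1) + 2 by ring, Nat.choose_symm_add]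
  rw [hch2] at hsupp
  have hsharp : (∑ l, (X : ℝ[X]) ^ (![0, 1, D] : Fin 3 → ℕ) l • (S l).map C).det.support.card ≤
      ((∑ l, (X : ℝ[X]) ^ (![0, 1, D] : Fin 3 → ℕ) l • (S l).map C).det.roots.toFinset.filter (fun t => 0 < t)).card + 1 := by
    omega
  obtain ⟨P, -, hP⟩ := skewBlock_cornerGraft_of_sharp (![0, 1, D] : Fin 3 → ℕ) 0 S hdet hsharp
  refine ⟨D, fun l => S l * P, ?_, ?_, fun D' => ?_⟩
  · rintro ⟨l, hl⟩ ⟨l', hl'⟩ hll'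
    rw [Fin.mk_lt_mk] at hll'
    interval_cases l <;> interval_cases l' <;> first | omega | (simp <;> omega)
  · rintro ⟨l, hl⟩
    interval_cases l
    · simp
    · simp
      omega
    · simp
  · obtain ⟨η, hη, h1, h2, h3⟩ := hP D'
    refine ⟨η, hη, h1, h2, le_trans ?_ h3⟩
    have := two_mul_choose_sub_one q
    omega

end CornerGraftQuadratic

section CornerGraftFinShape

/-! ## The planners' shape: one index type `Fin (2q+2)`, corner letter `vecMulVec eᵢ eᵢ` (the object of `TowerGraftLawCorner` verbatim) -/

/-- reindexing the corner matrix unit along an equivalence. [folklore] -/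
theorem submatrix_single_equiv {m n : Type*} [DecidableEq m] [DecidableEq n] {R : Type*} [Semiring R] (e : n ≃ m) (a : m) (r : R) :
    (Matrix.single a a r).submatrix e e = Matrix.single (e.symm a) (e.symm a) r := by
  ext x y
  simp only [Matrix.submatrix_apply, Matrix.single_apply, Equiv.symm_apply_eq]

/-- the two ways of deleting the corner index agree up to a relabelling: for an injection `g` into `α ⊕ Fin (q+1)` whose range is the complement
of `inr 0`, `M.submatrix g g` and `M.submatrix (Sum.map id 0.succAbove) (Sum.map id 0.succAbove)` have the same determinant. [folklore] -/
theorem det_submatrix_eq_of_range {α ι : Type*} [Fintype α] [DecidableEq α] [Fintype ι] [DecidableEq ι] {q : ℕ} {R : Type*} [CommRing R]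
    (M : Matrix (α ⊕ Fin (q + 1)) (α ⊕ Fin (q + 1)) R) (g : ι → α ⊕ Fin (q + 1)) (hg : Function.Injective g)
    (hrange : Set.range g = {Sum.inr 0}ᶜ) :
    (M.submatrix g g).det = (M.submatrix (Sum.map id (0 : Fin (q + 1)).succAbove) (Sum.map id (0 : Fin (q + 1)).succAbove)).det := by
  classical
  set f : α ⊕ Fin q → α ⊕ Fin (q + 1) := Sum.map id (0 : Fin (q + 1)).succAbove with hf
  have hfinj : Function.Injective f := Sum.map_injective.mpr ⟨Function.injective_id, Fin.succAbove_right_injective⟩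
  have hfrange : Set.range f = {Sum.inr 0}ᶜ := by
    ext x
    simp only [Set.mem_range, Set.mem_compl_iff, Set.mem_singleton_iff, hf]
    constructor
    · rintro ⟨y, rfl⟩
      rcases y with a | b
      · simp
      · simp
    · intro hx
      rcases x with a | b
      · exact ⟨Sum.inl a, rfl⟩
      · have hb : b ≠ 0 := fun h => hx (by rw [h])
        obtain ⟨c, hc⟩ := Fin.exists_succAbove_eq_iff.mpr hb
        exact ⟨Sum.inr c, by simpa using hc⟩
  -- the relabelling `σ` with `f ∘ σ = g`
  set σ : ι ≃ α ⊕ Fin q :=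
    (Equiv.ofInjective g hg).trans ((Equiv.setCongr (hrange.trans hfrange.symm)).trans (Equiv.ofInjective f hfinj).symm) with hσ
  have hσg : ∀ x, f (σ x) = g x := by
    intro x
    have h1 : ((Equiv.ofInjective f hfinj) (σ x) : α ⊕ Fin (q + 1)) =
        ((Equiv.setCongr (hrange.trans hfrange.symm)) (Equiv.ofInjective g hg x) : α ⊕ Fin (q + 1)) := by
      rw [hσ]
      simp only [Equiv.trans_apply, Equiv.apply_symm_apply]
    simpa using h1
  have hM : M.submatrix g g = (M.submatrix f f).submatrix σ σ := by
    ext x y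
    simp only [Matrix.submatrix_apply, hσg]
  rw [hM, Matrix.det_submatrix_equiv_self]

/-- **Θ(m²) CORNER-GRAFT PHANTOMS IN THE PLANNERS' SHAPE** (the object of `TowerGraftLawCorner` / S4b verbatim: ONE index type `Fin m`, symmetric
letters, corner letter `(vecMulVec eᵢ eᵢ).map C`, support an `m`-tower, corner exponent above the tower).  For every `q` (`m = 2q+2`) there is a
`D` with `(0, 1, D)` an `m`-tower such that for EVERY exponent `D'` there are symmetric letters `S` of size `m` and an index `i` with
`Z₊(det G) = 0`, `Z₊(det Gᵢᵢ) = 0` and `Z₊(det(G + X^{D'}·eᵢeᵢᵀ)) ≥ (q+1)(q+4) = m²/4 + 3m/2`.  (Transport of `skewBlock_cornerGraft_quadratic_tower`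
along `Fin (q+1) ⊕ Fin (q+1) ≃ Fin (2q+2)`.) [this work] -/
theorem cornerGraft_quadratic_tower_fin (q : ℕ) :
    ∃ D : ℕ, (∀ l l' : Fin 3, l < l' → (2 * q + 2) * (![0, 1, D] : Fin 3 → ℕ) l < (![0, 1, D] : Fin 3 → ℕ) l') ∧
      (∀ l : Fin 3, (2 * q + 2) * (![0, 1, D] : Fin 3 → ℕ) l < (2 * q + 2) * D + 1) ∧
      ∀ D' : ℕ, ∃ (S : Fin 3 → Matrix (Fin (2 * q + 2)) (Fin (2 * q + 2)) ℝ) (i : Fin (2 * q + 2)), (∀ l, (S l).IsSymm) ∧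
        ((∑ l, (X : ℝ[X]) ^ (![0, 1, D] : Fin 3 → ℕ) l • (S l).map C).det.roots.toFinset.filter (fun t => 0 < t)).card = 0 ∧
        (((∑ l, (X : ℝ[X]) ^ (![0, 1, D] : Fin 3 → ℕ) l • (S l).map C).submatrix i.succAbove i.succAbove).det.roots.toFinset.filter
          (fun t => 0 < t)).card = 0 ∧
        (q + 1) * (q + 4) ≤ ((((∑ l, (X : ℝ[X]) ^ (![0, 1, D] : Fin 3 → ℕ) l • (S l).map C) +
          (X : ℝ[X]) ^ D' • (Matrix.vecMulVec (Pi.single i (1 : ℝ)) (Pi.single i (1 : ℝ))).map C).det).roots.toFinset.filter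
          (fun t => 0 < t)).card := by
  classical
  obtain ⟨D, B, htow, htop, hall⟩ := skewBlock_cornerGraft_quadratic_tower q
  have h2q : 2 * (q + 1) = 2 * q + 2 := by ring
  rw [h2q] at htow htop
  have hm : q + 1 + (q + 1) = 2 * q + 2 := by ring
  -- the relabelling `Fin (q+1) ⊕ Fin (q+1) ≃ Fin (2q+2)`
  set e : Fin (q + 1) ⊕ Fin (q + 1) ≃ Fin (2 * q + 2) := finSumFinEquiv.trans (finCongr hm) with he
  refine ⟨D, htow, htop, fun D' => ?_⟩
  obtain ⟨η, hη, h1, h2, h3⟩ := hall D'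
  set T : Fin 3 → Matrix (Fin (q + 1) ⊕ Fin (q + 1)) (Fin (q + 1) ⊕ Fin (q + 1)) ℝ := fun l =>
    Matrix.fromBlocks (if l = 0 then η • (1 : Matrix (Fin (q + 1)) (Fin (q + 1)) ℝ) else 0) (B l) (B l)ᵀ
      (if l = 0 then -(η • (1 : Matrix (Fin (q + 1)) (Fin (q + 1)) ℝ)) else 0) with hT
  set i : Fin (2 * q + 2) := e (Sum.inr 0) with hi
  refine ⟨fun l => (T l).submatrix e.symm e.symm, i, fun l => ?_, ?_, ?_, ?_⟩
  · exact (isSymm_skewBlock_letter 0 l η B).submatrix _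
  · -- the pencil of the relabelled letters is the relabelled pencil; same determinant
    rw [← submatrix_pencil', Matrix.det_submatrix_equiv_self]
    exact h1
  · rw [← submatrix_pencil', Matrix.submatrix_submatrix]
    rw [det_submatrix_eq_of_range _ (e.symm ∘ i.succAbove) (e.symm.injective.comp Fin.succAbove_right_injective) ?_]
    · exact h2
    · rw [Set.range_comp, Fin.range_succAbove, hi]
      ext x
      simp only [Set.mem_image, Set.mem_compl_iff, Set.mem_singleton_iff]
      constructor
      · rintro ⟨y, hy, rfl⟩
        intro h0
        exact hy (by rw [← h0, Equiv.apply_symm_apply])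
      · intro hx
        exact ⟨e x, fun h0 => hx (e.injective h0), Equiv.symm_apply_apply e x⟩
  · have hsingle : Matrix.single i i (1 : ℝ[X]) =
        (Matrix.single (Sum.inr 0 : Fin (q + 1) ⊕ Fin (q + 1)) (Sum.inr 0) (1 : ℝ[X])).submatrix e.symm e.symm := by
      rw [submatrix_single_equiv, Equiv.symm_symm]
    have hsub : ((∑ l, (X : ℝ[X]) ^ (![0, 1, D] : Fin 3 → ℕ) l • (T l).map C).submatrix e.symm e.symm +
        (X : ℝ[X]) ^ D' • (Matrix.single (Sum.inr 0 : Fin (q + 1) ⊕ Fin (q + 1)) (Sum.inr 0) (1 : ℝ[X])).submatrix e.symm e.symm) =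
        ((∑ l, (X : ℝ[X]) ^ (![0, 1, D] : Fin 3 → ℕ) l • (T l).map C) +
          (X : ℝ[X]) ^ D' • Matrix.single (Sum.inr 0 : Fin (q + 1) ⊕ Fin (q + 1)) (Sum.inr 0) (1 : ℝ[X])).submatrix e.symm e.symm := rfl
    rw [vecMulVec_single_one_map, ← submatrix_pencil', hsingle, hsub, Matrix.det_submatrix_equiv_self]
    exact h3

end CornerGraftFinShape

end Summit.ValiantsHypothesis.ValiantsHypothesis.Theorems.KPlusLogSqLaw.TowerGraft
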